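import Summits.NavierStokesRegularity.FunctionalMining.SaturatingLawSup
import Summits.NavierStokesRegularity.FunctionalMining.StrainMomentSaturatingLaw
import Summits.NavierStokesRegularity.FunctionalMining.SaturatingLawTransport
import HarnessLib
/-!
# FunctionalMining — two bookkeeping lemmas for the one-sided law `SaturatingLawSup`:
# perturbation by a rate-budget functional, and the vanishing-perturbation limit

HONEST FRAMING. Search for candidate a priori estimates; no regularity claim. Cell `pub-nsfunc`,
dict seat (gen 34), staged as `pub-nsfunc-dict/SpectralMixtureCandidates.lean` (sha256
b69cec1c038e0a61, 408 lines) and filed by the prove seat (gen 24) in TWO parts for the 400-line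
lint: THIS file = the staged file's first section (differentiability along solutions,
`SaturatingLawSup.add_smul`, `SaturatingLawSup.of_add_smul_tendsto_zero`), declarations
byte-identical and in the staged order; the K1-Q6 typed candidates (a)/(b)/(c) built on them are
`SpectralMixtureCandidates.lean`. Nothing about Navier–Stokes is asserted: the theorems are
bookkeeping about the one-sided-derivative-value law `SaturatingLawSup` (`SaturatingLawSup.lean`).

* `DifferentiableAlongNS G` — `s ↦ G (u s)` is differentiable within `[a, b]` at every time along
  every zero-mean classical solution of unforced Navier–Stokes on `T³` (`ν > 0`); rate-budget laws
  and two-sided saturating laws supply it (`IsRateBudget.differentiableAlongNS`,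
  `SaturatingLaw.differentiableAlongNS`).
* **`SaturatingLawSup.add_smul`** — Sup-law for `F` with `κF` and `IsRateBudget`-law for `G` with
  `κG` give the Sup-law for `F + εG` with `κF + ε^{−1/σ} κG` (`ε > 0`).
* **`SaturatingLawSup.of_add_smul_tendsto_zero`** — laws for `F + εₙG` with ONE constant `κ` along
  `εₙ → 0`, `G` differentiable along solutions, give the law for `F` with `κ` (the door D-K6 (a)
  clause "necessarily `κ(ε) → ∞`" as a kernel lemma).

[ours, bookkeeping]
-/

noncomputable section

open MeasureTheory Set Filter Topology

namespace Summit.NavierStokesRegularity.FunctionalMining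

open Literature.Analysis.FunctionSpaces Literature.Analysis.FluidPDE

variable {d : Type*} [Fintype d] [DecidableEq d]

/-! ### Differentiability along solutions, and two bookkeeping lemmas for `SaturatingLawSup` -/

/-- `G` is differentiable along solutions: for `d = 3`, along every zero-mean classical solution of
unforced Navier–Stokes (`ν > 0`) on `[a, b]`, `s ↦ G (u s)` is differentiable within `[a, b]` at every
time — the differentiability clause of `IsRateBudget`. [ours, bookkeeping] -/
def DifferentiableAlongNS (G : (UnitAddTorus d → EuclideanSpace ℝ d) → ℝ) : Prop :=
  Fintype.card d = 3 → ∀ ⦃ν : ℝ⦄, 0 < ν → ∀ ⦃a b : ℝ⦄, a < b →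
    ∀ ⦃u : ℝ → UnitAddTorus d → EuclideanSpace ℝ d⦄ ⦃p : ℝ → UnitAddTorus d → ℝ⦄,
      Torus.IsClassicalNSSolutionOn (Icc a b) ν 0 u p →
      (∀ t ∈ Icc a b, Torus.HasZeroMean (u t)) →
      ∀ t ∈ Icc a b, DifferentiableWithinAt ℝ (fun s => G (u s)) (Icc a b) t

/-- A rate budget contains the differentiability clause. [ours, bookkeeping] -/
theorem IsRateBudget.differentiableAlongNS {G : (UnitAddTorus d → EuclideanSpace ℝ d) → ℝ}
    {B : ℝ → (UnitAddTorus d → EuclideanSpace ℝ d) → ℝ} (h : IsRateBudget G B) :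
    DifferentiableAlongNS G :=
  fun hd _ hν _ _ hab _ _ hsol hmean t ht => (h hd hν hab hsol hmean t ht).1

/-- A saturating law in the `IsRateBudget` form contains the differentiability clause. [ours, bookkeeping] -/
theorem SaturatingLaw.differentiableAlongNS {G : (UnitAddTorus d → EuclideanSpace ℝ d) → ℝ}
    {σ γ κ : ℝ} (h : SaturatingLaw (d := d) G σ γ κ) : DifferentiableAlongNS G :=
  IsRateBudget.differentiableAlongNS h

/-- **Perturbation lemma.** If `F ≥ 0` obeys the one-sided-derivative-value law with `κF ≥ 0`, and `G ≥ 0`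
obeys the law in the `IsRateBudget` form (differentiable along solutions) with `κG ≥ 0`, at the same
exponents with `0 ≤ 1 + 1/σ`, then for `ε > 0` the mixture `F + ε G` obeys the one-sided-derivative-value
law with constant `κF + ε^{−1/σ} κG`: a derivative value `R` of `F + εG` minus `ε G'` is a derivative value
of `F`, and `F^{1+1/σ} ≤ (F+εG)^{1+1/σ}`, `ε G^{1+1/σ} = ε^{−1/σ} (εG)^{1+1/σ} ≤ ε^{−1/σ} (F+εG)^{1+1/σ}`.
[ours, bookkeeping] -/
theorem SaturatingLawSup.add_smul {F G : (UnitAddTorus d → EuclideanSpace ℝ d) → ℝ}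
    {σ γ κF κG ε : ℝ} (hF : SaturatingLawSup (d := d) F σ γ κF) (hG : SaturatingLaw (d := d) G σ γ κG)
    (hF0 : ∀ v, 0 ≤ F v) (hG0 : ∀ v, 0 ≤ G v) (hκF : 0 ≤ κF) (hκG : 0 ≤ κG) (hp : 0 ≤ 1 + σ⁻¹)
    (hε : 0 < ε) :
    SaturatingLawSup (d := d) (fun v => F v + ε * G v) σ γ (κF + ε ^ (-σ⁻¹) * κG) := by
  intro hd ν hν a b hab u p hsol hmean t ht R hR
  obtain ⟨hGd, hGle⟩ := hG hd hν hab hsol hmean t ht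
  set RG := derivWithin (fun s => G (u s)) (Icc a b) t with hRG_def
  have hRG : HasDerivWithinAt (fun s => G (u s)) RG (Icc a b) t := hGd.hasDerivWithinAt
  -- `F = (F + εG) − εG` has derivative value `R − ε RG`
  have hRF : HasDerivWithinAt (fun s => F (u s)) (R - ε * RG) (Icc a b) t := by
    have h := hR.sub (hRG.const_mul ε)
    refine h.congr (fun s _ => ?_) ?_ <;> simp
  have h1 : R - ε * RG ≤ κF * ν ^ (-γ) * (2 * torusEnstrophy (u t)) * F (u t) ^ (1 + σ⁻¹) :=
    hF hd hν hab hsol hmean t ht _ hRF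
  -- abbreviations
  set X := ν ^ (-γ) * (2 * torusEnstrophy (u t)) with hX_def
  have hX : 0 ≤ X := mul_nonneg (Real.rpow_nonneg hν.le _) (mul_nonneg (by norm_num) (torusEnstrophy_nonneg _))
  set H := F (u t) + ε * G (u t) with hH_def
  have hFt : 0 ≤ F (u t) := hF0 _
  have hGt : 0 ≤ G (u t) := hG0 _
  have hεG : 0 ≤ ε * G (u t) := mul_nonneg hε.le hGt
  have hH0 : 0 ≤ H := add_nonneg hFt hεG
  have hFH : F (u t) ^ (1 + σ⁻¹) ≤ H ^ (1 + σ⁻¹) :=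
    Real.rpow_le_rpow hFt (le_add_of_nonneg_right hεG) hp
  have hGH : ε * G (u t) ^ (1 + σ⁻¹) ≤ ε ^ (-σ⁻¹) * H ^ (1 + σ⁻¹) := by
    have h2 : (ε * G (u t)) ^ (1 + σ⁻¹) ≤ H ^ (1 + σ⁻¹) :=
      Real.rpow_le_rpow hεG (le_add_of_nonneg_left hFt) hp
    have h3 : (ε * G (u t)) ^ (1 + σ⁻¹) = ε ^ (1 + σ⁻¹) * G (u t) ^ (1 + σ⁻¹) :=
      Real.mul_rpow hε.le hGt
    have h4 : ε = ε ^ (-σ⁻¹) * ε ^ (1 + σ⁻¹) := by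
      rw [← Real.rpow_add hε]; norm_num
    calc ε * G (u t) ^ (1 + σ⁻¹) = ε ^ (-σ⁻¹) * (ε ^ (1 + σ⁻¹) * G (u t) ^ (1 + σ⁻¹)) := by
          rw [← mul_assoc, ← h4]
      _ = ε ^ (-σ⁻¹) * (ε * G (u t)) ^ (1 + σ⁻¹) := by rw [h3]
      _ ≤ ε ^ (-σ⁻¹) * H ^ (1 + σ⁻¹) :=
          mul_le_mul_of_nonneg_left h2 (Real.rpow_nonneg hε.le _)
  have h5 : RG ≤ κG * ν ^ (-γ) * (2 * torusEnstrophy (u t)) * G (u t) ^ (1 + σ⁻¹) := hGle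
  have h6 : ε * RG ≤ ε * (κG * X * G (u t) ^ (1 + σ⁻¹)) := by
    have : κG * ν ^ (-γ) * (2 * torusEnstrophy (u t)) * G (u t) ^ (1 + σ⁻¹) =
        κG * X * G (u t) ^ (1 + σ⁻¹) := by rw [hX_def]; ring
    rw [← this]; exact mul_le_mul_of_nonneg_left h5 hε.le
  have h7 : κF * ν ^ (-γ) * (2 * torusEnstrophy (u t)) * F (u t) ^ (1 + σ⁻¹) =
      κF * X * F (u t) ^ (1 + σ⁻¹) := by rw [hX_def]; ring
  calc R = (R - ε * RG) + ε * RG := by ring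
    _ ≤ κF * X * F (u t) ^ (1 + σ⁻¹) + ε * (κG * X * G (u t) ^ (1 + σ⁻¹)) := by
        rw [← h7]; exact add_le_add h1 h6
    _ = κF * X * F (u t) ^ (1 + σ⁻¹) + κG * X * (ε * G (u t) ^ (1 + σ⁻¹)) := by ring
    _ ≤ κF * X * H ^ (1 + σ⁻¹) + κG * X * (ε ^ (-σ⁻¹) * H ^ (1 + σ⁻¹)) :=
        add_le_add (mul_le_mul_of_nonneg_left hFH (mul_nonneg hκF hX))
          (mul_le_mul_of_nonneg_left hGH (mul_nonneg hκG hX))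
    _ = (κF + ε ^ (-σ⁻¹) * κG) * ν ^ (-γ) * (2 * torusEnstrophy (u t)) * H ^ (1 + σ⁻¹) := by
        rw [hX_def]; ring

/-- **Necessity lemma (passage to the limit in a vanishing perturbation).** If the mixtures `F + εₙ G`
obey the one-sided-derivative-value law with ONE constant `κ` along a sequence `εₙ → 0`, `G` is
differentiable along solutions and `0 ≤ 1 + 1/σ`, then `F` obeys the law with the same `κ`: at a
derivative value `R` of `F`, `R + εₙ G'` is a derivative value of `F + εₙ G`, and both sides of the law pass
to the limit (`x ↦ x^{1+1/σ}` is continuous). This is the door's clause "NECESSARILY κ(ε) → ∞ as ε ↓ 0"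
(NOGO D-K6 (a)) as a kernel lemma. [ours, bookkeeping] -/
theorem SaturatingLawSup.of_add_smul_tendsto_zero {F G : (UnitAddTorus d → EuclideanSpace ℝ d) → ℝ}
    {σ γ κ : ℝ} {ε : ℕ → ℝ} (hlaw : ∀ n, SaturatingLawSup (d := d) (fun v => F v + ε n * G v) σ γ κ)
    (hε : Tendsto ε atTop (𝓝 0)) (hG : DifferentiableAlongNS G) (hp : 0 ≤ 1 + σ⁻¹) :
    SaturatingLawSup (d := d) F σ γ κ := by
  intro hd ν hν a b hab u p hsol hmean t ht R hR
  have hGd := hG hd hν hab hsol hmean t ht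
  set RG := derivWithin (fun s => G (u s)) (Icc a b) t with hRG_def
  have hRG : HasDerivWithinAt (fun s => G (u s)) RG (Icc a b) t := hGd.hasDerivWithinAt
  have hn : ∀ n, R + ε n * RG ≤
      κ * ν ^ (-γ) * (2 * torusEnstrophy (u t)) * (F (u t) + ε n * G (u t)) ^ (1 + σ⁻¹) := by
    intro n
    have h := hR.add (hRG.const_mul (ε n))
    exact hlaw n hd hν hab hsol hmean t ht _ (h.congr (fun s _ => by simp) (by simp))
  have hL : Tendsto (fun n => R + ε n * RG) atTop (𝓝 R) := by
    simpa using ((hε.mul_const RG).const_add R)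
  have hH : Tendsto (fun n => F (u t) + ε n * G (u t)) atTop (𝓝 (F (u t))) := by
    simpa using ((hε.mul_const (G (u t))).const_add (F (u t)))
  have hP : Tendsto (fun n => (F (u t) + ε n * G (u t)) ^ (1 + σ⁻¹)) atTop
      (𝓝 (F (u t) ^ (1 + σ⁻¹))) :=
    ((Real.continuousAt_rpow_const _ _ (Or.inr hp)).tendsto).comp hH
  have hRHS : Tendsto (fun n => κ * ν ^ (-γ) * (2 * torusEnstrophy (u t)) *
      (F (u t) + ε n * G (u t)) ^ (1 + σ⁻¹)) atTop
      (𝓝 (κ * ν ^ (-γ) * (2 * torusEnstrophy (u t)) * F (u t) ^ (1 + σ⁻¹))) :=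
    hP.const_mul _
  exact le_of_tendsto_of_tendsto' hL hRHS hn

end Summit.NavierStokesRegularity.FunctionalMining

end
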